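import Mathlib
import HarnessLib
import Summits.KontsevichZagierPeriods.KontsevichZagierPeriods.Theses.LinRedNormalForm
import Summits.KontsevichZagierPeriods.KontsevichZagierPeriods.Theorems.LinRedNormalFormDihedralNormalFormVertexSplitting
import Summits.KontsevichZagierPeriods.KontsevichZagierPeriods.Theorems.LinRedNormalFormDihedralNormalFormStubDilationNLAux1

/-!
# `DihedralNormalForm`, line `torus-descent-sum-shadow`, stub `stub_deRham` — the monomial
# translation move (Aux 1)

Support file for the stub `stub_deRham` (effective convergent de Rham reduction of simplicial
Laurent monomials) of the crux `DihedralNormalForm` (stmt-KontsevichZagierPeriods-3912, route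
`LinRedNormalForm`).  **The translation move for a Laurent-monomial primitive**: Kontsevich–Zagier's
rule (3) along the axis `p` of the open ordered simplex `Δᵏ⁺¹ = {1 > t₀ > ⋯ > t_k > 0}`
(`VertexSplitting.nl_axis_osimplex`) with primitive the simplicial Laurent monomial
`P = q·∏ tᵢ^{βᵢ}(1-tᵢ)^{γᵢ}∏_{i<j}(tᵢ-tⱼ)^{αᵢⱼ}` (`Dilation.smono`) and bulk `∂_p P = P · ∂_p log P`, where
`∂_p log P = Dilation.logDer β γ α · e_p = β_p/t_p − γ_p/(1−t_p) + Σ_{j>p} α_{pj}/(t_p−t_j) − Σ_{i<p} α_{ip}/(t_i−t_p)`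
(`logDer_single`) is the logarithmic derivative of `P` along the axis.  All analytic side
conditions of the move are discharged here once and for all (the file introduces no definitions):

* `ℚ`-semialgebraicity of `P` and of the bulk on the axis band (`isSemialgebraicFunOn_smono_sband`,
  `isSemialgebraicFunOn_logDer_single`, `isSemialgebraicFunOn_bulk_sband`);
* the derivative of `P` along the axis (`hasDerivAt_smono_axis`, from
  `Dilation.hasDerivAt_smono_affine`: the fibre `u ↦ insertNth p u y` is an affine path);
* continuity of `P` on the CLOSED fibre `[loEdge p y, hiEdge p y]` as soon as the two letters that
  collapse at the end points — `t_{p-1} - t_p` (or `1 - t₀` when `p = 0`) and `t_p - t_{p+1}`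
  (or `t_k` when `p = k`) — carry non-negative exponents (`continuousOn_smono_axis`).

The move (`smono_axis_move`): if `R = [Δᵏ⁺¹, P · ∂_p log P]` and
`rb = [Δᵏ, P|_{t_p = hiEdge} − P|_{t_p = loEdge}]` are representations and the two adjacent
exponents are `≥ 0`, then `[R] − [rb] ∈ KZ.relations`.  The registered form `stub_deRhamAux1`
spells everything out.  This is integration by parts for Selberg/Aomoto-type integrands: the bulk
is the combination `Σ_{f ∋ p} ± n_f · P/f` of the monomials `P/f` over the letters `f` through the
axis, the faces are monomials of one dimension less.

References: M. Kontsevich, D. Zagier, *Periods* (2001), §1.2 rule (3); F. Brown, *Multiple zeta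
values and periods of moduli spaces* `𝔐_{0,n}`, Ann. Sci. ÉNS 42 (2009), §8 (Stokes on the cell).
-/

noncomputable section

open MeasureTheory Set

namespace Summit.KontsevichZagierPeriods.DihedralNormalForm.TorusDescent

open Literature.NumberTheory.Transcendental
open Literature.ModelTheory.ExponentialFields (IsSemialgebraic)
open Summit.KontsevichZagierPeriods.DihedralNormalForm.VertexSplitting
open Dilation (smono logDer hasDerivAt_smono_affine isSemialgebraicFunOn_smono_comp)

namespace TranslationNL

variable {k : ℕ}

/-! ### The logarithmic derivative along an axis -/

/-- **The logarithmic derivative of the monomial along the axis `p`** (`Dilation.logDer` in the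
coordinate direction `e_p`), explicitly:
`β_p/t_p − γ_p/(1−t_p) + Σ_{j>p} α_{pj}/(t_p−t_j) − Σ_{i<p} α_{ip}/(t_i−t_p)`. [folklore] -/
theorem logDer_single (p : Fin (k + 1)) (β γ : Fin (k + 1) → ℤ) (α : Fin (k + 1) → Fin (k + 1) → ℤ)
    (t : Fin (k + 1) → ℝ) :
    logDer β γ α t (Pi.single p 1) = (β p : ℝ) / t p - (γ p : ℝ) / (1 - t p) +
      ((∑ j, if p < j then (α p j : ℝ) / (t p - t j) else 0) -
        ∑ i, if i < p then (α i p : ℝ) / (t i - t p) else 0) := by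
  unfold logDer
  have h1 : (∑ i, (β i : ℝ) * (Pi.single p (1:ℝ) : Fin (k + 1) → ℝ) i / t i) = (β p : ℝ) / t p := by
    rw [Finset.sum_eq_single p]
    · simp
    · intro i _ hi
      simp [hi]
    · simp
  have h2 : (∑ i, (γ i : ℝ) * (-(Pi.single p (1:ℝ) : Fin (k + 1) → ℝ) i) / (1 - t i)) =
      -((γ p : ℝ) / (1 - t p)) := by
    rw [Finset.sum_eq_single p]
    · simp [neg_div]
    · intro i _ hi
      simp [hi]
    · simp
  have h3 : (∑ i, ∑ j, if i < j then
      (α i j : ℝ) * ((Pi.single p (1:ℝ) : Fin (k + 1) → ℝ) i - (Pi.single p (1:ℝ) : Fin (k + 1) → ℝ) j) /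
        (t i - t j) else 0) =
      (∑ j, if p < j then (α p j : ℝ) / (t p - t j) else 0) -
        ∑ i, if i < p then (α i p : ℝ) / (t i - t p) else 0 := by
    have hsplit : ∀ i j : Fin (k + 1), (if i < j then
        (α i j : ℝ) * ((Pi.single p (1:ℝ) : Fin (k + 1) → ℝ) i - (Pi.single p (1:ℝ) : Fin (k + 1) → ℝ) j) /
          (t i - t j) else 0) =
        (if i = p then (if p < j then (α p j : ℝ) / (t p - t j) else 0) else 0) -
          (if j = p then (if i < p then (α i p : ℝ) / (t i - t p) else 0) else 0) := by
      intro i j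
      by_cases hi : i = p
      · subst hi
        by_cases hj : j = i
        · subst hj; simp
        · rw [if_pos rfl, if_neg hj, sub_zero, Pi.single_eq_same, Pi.single_eq_of_ne hj, sub_zero, mul_one]
      · rw [if_neg hi, zero_sub, Pi.single_eq_of_ne hi]
        by_cases hj : j = p
        · subst hj
          rw [if_pos rfl, Pi.single_eq_same]
          split_ifs <;> ring
        · rw [if_neg hj, Pi.single_eq_of_ne hj]
          split_ifs <;> ring
    simp_rw [hsplit, Finset.sum_sub_distrib]
    congr 1
    · rw [Finset.sum_comm]
      simp
    · simp
  rw [h1, h2, h3]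
  ring

/-! ### The fibre of the axis is an affine path -/

/-- `insertNth p u y = insertNth p 0 y + u • e_p`. [folklore] -/
theorem insertNth_eq_affine (p : Fin (k + 1)) (u : ℝ) (y : Fin k → ℝ) :
    (Fin.insertNth p u y : Fin (k + 1) → ℝ) =
      (Fin.insertNth p (0:ℝ) y : Fin (k + 1) → ℝ) + u • (Pi.single p (1:ℝ) : Fin (k + 1) → ℝ) := by
  ext i
  rcases Fin.eq_self_or_eq_succAbove p i with rfl | ⟨j, rfl⟩
  · simp
  · simp [Fin.succAbove_ne]

/-- The letters of a point of the open ordered simplex are non-degenerate. [folklore] -/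
theorem letters_ne_zero {n : ℕ} {x : Fin n → ℝ} (hx : x ∈ KZ.openOrderedSimplex n) :
    (∀ i, x i ≠ 0) ∧ (∀ i, 1 - x i ≠ 0) ∧ (∀ i j, i < j → x i - x j ≠ 0) :=
  ⟨fun i => (hx.1 i).ne', fun i => (sub_pos.2 (hx.2.1 i)).ne',
    fun _ _ hij => (sub_pos.2 (hx.2.2 hij)).ne'⟩

/-- **The derivative of the monomial along the axis** `p`, on the open fibre over a point of the
ordered `k`-simplex: `∂_u P(insertNth p u y) = P · ∂_p log P`. [folklore] -/
theorem hasDerivAt_smono_axis (p : Fin (k + 1)) (q : ℚ) (β γ : Fin (k + 1) → ℤ)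
    (α : Fin (k + 1) → Fin (k + 1) → ℤ) {y : Fin k → ℝ} (hy : y ∈ KZ.openOrderedSimplex k)
    {u : ℝ} (hu : u ∈ Ioo (loEdge p y) (hiEdge p y)) :
    HasDerivAt (fun s : ℝ => smono q β γ α (Fin.insertNth p s y))
      (smono q β γ α (Fin.insertNth p u y) *
        logDer β γ α (Fin.insertNth p u y) (Pi.single p 1)) u := by
  have hmem : (Fin.insertNth p u y : Fin (k + 1) → ℝ) ∈ KZ.openOrderedSimplex (k + 1) :=
    (insertNth_mem_iff_edges p hy u).2 hu
  obtain ⟨h0, h1, h2⟩ := letters_ne_zero hmem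
  have hfun : (fun s : ℝ => smono q β γ α (Fin.insertNth p s y)) = fun s =>
      smono q β γ α ((Fin.insertNth p (0:ℝ) y : Fin (k + 1) → ℝ) + s • (Pi.single p (1:ℝ))) :=
    funext fun s => by rw [insertNth_eq_affine]
  rw [hfun]
  have hpt : (Fin.insertNth p (0:ℝ) y : Fin (k + 1) → ℝ) + u • (Pi.single p (1:ℝ) : Fin (k + 1) → ℝ) =
      Fin.insertNth p u y := (insertNth_eq_affine p u y).symm
  have hpt' : ∀ i, (Fin.insertNth p (0:ℝ) y : Fin (k + 1) → ℝ) i +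
      u * (Pi.single p (1:ℝ) : Fin (k + 1) → ℝ) i = (Fin.insertNth p u y : Fin (k + 1) → ℝ) i := by
    intro i
    have := congrFun hpt i
    simpa using this
  have h := hasDerivAt_smono_affine q β γ α (Fin.insertNth p (0:ℝ) y) (Pi.single p 1) u
    (fun i => by rw [hpt']; exact h0 i) (fun i => by rw [hpt']; exact h1 i)
    (fun i j hij => by rw [hpt', hpt']; exact h2 i j hij)
  rw [hpt] at h
  exact h

/-! ### Continuity on the closed fibre -/

/-- The coordinates of the fibre are continuous in the axis parameter. [folklore] -/
theorem continuous_insertNth_apply (p : Fin (k + 1)) (y : Fin k → ℝ) (i : Fin (k + 1)) :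
    Continuous fun u : ℝ => (Fin.insertNth p u y : Fin (k + 1) → ℝ) i := by
  rcases Fin.eq_self_or_eq_succAbove p i with rfl | ⟨j, rfl⟩
  · simp only [Fin.insertNth_apply_same]; exact continuous_id
  · simp only [Fin.insertNth_apply_succAbove]; exact continuous_const

/-- **Continuity of the monomial on the closed fibre.**  If the letter collapsing at the upper end
point (`t_{p-1} - t_p`, or `1 - t₀` when `p = 0`) and the letter collapsing at the lower end point
(`t_p - t_{p+1}`, or `t_k` when `p = k`) have non-negative exponents, then
`u ↦ P(insertNth p u y)` is continuous on `[loEdge p y, hiEdge p y]`. [folklore] -/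
theorem continuousOn_smono_axis (p : Fin (k + 1)) (q : ℚ) (β γ : Fin (k + 1) → ℤ)
    (α : Fin (k + 1) → Fin (k + 1) → ℤ) {y : Fin k → ℝ} (hy : y ∈ KZ.openOrderedSimplex k)
    (hhi : if h : 0 < (p : ℕ) then 0 ≤ α ⟨(p : ℕ) - 1, by omega⟩ p else 0 ≤ γ p)
    (hlo : if h : (p : ℕ) < k then 0 ≤ α p ⟨(p : ℕ) + 1, by omega⟩ else 0 ≤ β p) :
    ContinuousOn (fun u : ℝ => smono q β γ α (Fin.insertNth p u y)) (Icc (loEdge p y) (hiEdge p y)) := by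
  obtain ⟨hy0, hy1, hya⟩ := hy
  -- the values of the coordinates on the closed fibre
  have hIcc : ∀ {u : ℝ}, u ∈ Icc (loEdge p y) (hiEdge p y) → loEdge p y ≤ u ∧ u ≤ hiEdge p y :=
    fun hu => hu
  have hc := continuous_insertNth_apply p y
  unfold smono
  refine continuousOn_const.mul ((ContinuousOn.mul ?_ ?_).mul ?_)
  · -- the letters `tᵢ`
    refine continuousOn_finsetProd _ fun i _ => ((hc i).continuousOn).zpow₀ _ fun u hu => ?_
    rcases Fin.eq_self_or_eq_succAbove p i with rfl | ⟨j, rfl⟩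
    · simp only [Fin.insertNth_apply_same]
      by_cases hpk : (i : ℕ) < k
      · left
        have hlo' : loEdge i y = y ⟨i, hpk⟩ := by simp [loEdge, hpk]
        exact (lt_of_lt_of_le (hlo' ▸ hy0 _) (hIcc hu).1).ne'
      · right
        rw [dif_neg hpk] at hlo
        exact hlo
    · left
      simp only [Fin.insertNth_apply_succAbove]
      exact (hy0 j).ne'
  · -- the letters `1 - tᵢ`
    refine continuousOn_finsetProd _ fun i _ =>
      ((continuous_const.sub (hc i)).continuousOn).zpow₀ _ fun u hu => ?_
    rcases Fin.eq_self_or_eq_succAbove p i with rfl | ⟨j, rfl⟩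
    · simp only [Fin.insertNth_apply_same]
      by_cases hp0 : 0 < (i : ℕ)
      · left
        have hhi' : hiEdge i y = y ⟨(i : ℕ) - 1, by omega⟩ := by simp [hiEdge, hp0]
        have : u < 1 := lt_of_le_of_lt (hIcc hu).2 (hhi' ▸ hy1 _)
        exact (sub_pos.2 this).ne'
      · right
        rw [dif_neg hp0] at hhi
        exact hhi
    · left
      simp only [Fin.insertNth_apply_succAbove]
      exact (sub_pos.2 (hy1 j)).ne'
  · -- the letters `tᵢ - tⱼ`
    refine continuousOn_finsetProd _ fun i _ => continuousOn_finsetProd _ fun j _ => ?_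
    by_cases hij : i < j
    · simp only [if_pos hij]
      refine (((hc i).sub (hc j)).continuousOn).zpow₀ _ fun u hu => ?_
      rcases Fin.eq_self_or_eq_succAbove p i with rfl | ⟨i', rfl⟩
      · -- `i = p < j = succAbove p j'`, `t_j = y_{j'}` with `p ≤ castSucc j'`
        rcases Fin.eq_self_or_eq_succAbove i j with rfl | ⟨j', rfl⟩
        · exact absurd hij (lt_irrefl _)
        · simp only [Fin.insertNth_apply_same, Fin.insertNth_apply_succAbove]
          have hpj : (i : ℕ) ≤ (j' : ℕ) := by
            by_contra hlt
            have h1 : Fin.castSucc j' < i := Fin.lt_def.2 (by simp; omega)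
            rw [Fin.succAbove_of_castSucc_lt _ _ h1] at hij
            exact absurd (Fin.lt_def.1 hij) (by simp; omega)
          have hpk : (i : ℕ) < k := lt_of_le_of_lt hpj j'.2
          have hlo' : loEdge i y = y ⟨i, hpk⟩ := by simp [loEdge, hpk]
          rcases eq_or_lt_of_le hpj with he | hlt
          · -- the adjacent letter `t_p - t_{p+1}`
            by_cases hu' : y j' < u
            · exact Or.inl (sub_pos.2 hu').ne'
            · right
              rw [dif_pos hpk] at hlo
              have hj' : i.succAbove j' = ⟨(i : ℕ) + 1, by omega⟩ := by
                rw [Fin.succAbove_of_le_castSucc _ _ (Fin.le_def.2 (by simp; omega))]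
                exact Fin.ext (by simp; omega)
              rw [hj'] at *
              exact hlo
          · left
            have : y j' < y ⟨i, hpk⟩ := hya (Fin.lt_def.2 (by simpa using hlt))
            exact (sub_pos.2 (lt_of_lt_of_le this (hlo' ▸ (hIcc hu).1))).ne'
      · rcases Fin.eq_self_or_eq_succAbove p j with rfl | ⟨j', rfl⟩
        · -- `i = succAbove p i' < p = j`, `t_i = y_{i'}` with `castSucc i' < p`
          simp only [Fin.insertNth_apply_same, Fin.insertNth_apply_succAbove]
          have hip : (i' : ℕ) < (j : ℕ) := by
            by_contra hle
            have h1 : j ≤ Fin.castSucc i' := Fin.le_def.2 (by simp; omega)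
            rw [Fin.succAbove_of_le_castSucc _ _ h1] at hij
            exact absurd (Fin.lt_def.1 hij) (by simp; omega)
          have hp0 : 0 < (j : ℕ) := lt_of_le_of_lt (Nat.zero_le _) hip
          have hhi' : hiEdge j y = y ⟨(j : ℕ) - 1, by omega⟩ := by simp [hiEdge, hp0]
          by_cases he : (i' : ℕ) + 1 = (j : ℕ)
          · -- the adjacent letter `t_{p-1} - t_p`
            by_cases hu' : u < y i'
            · exact Or.inl (sub_pos.2 hu').ne'
            · right
              rw [dif_pos hp0] at hhi
              have hi' : j.succAbove i' = ⟨(j : ℕ) - 1, by omega⟩ := by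
                rw [Fin.succAbove_of_castSucc_lt _ _ (Fin.lt_def.2 (by simp; omega))]
                exact Fin.ext (by simp; omega)
              rw [hi'] at *
              exact hhi
          · left
            have hlt : y ⟨(j : ℕ) - 1, by omega⟩ < y i' := hya (Fin.lt_def.2 (by simp; omega))
            exact (sub_pos.2 (lt_of_le_of_lt ((hIcc hu).2.trans hhi'.le) hlt)).ne'
        · left
          simp only [Fin.insertNth_apply_succAbove]
          have : i' < j' := (Fin.strictMono_succAbove p).lt_iff_lt.1 hij
          exact (sub_pos.2 (hya this)).ne'
    · simp only [if_neg hij]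
      exact continuousOn_const

/-! ### Semialgebraicity on the axis band -/

/-- The monomial is `ℚ`-semialgebraic on the axis band. [cite: BochnakCosteRoy1998, Prop. 2.2.6] -/
theorem isSemialgebraicFunOn_smono_sband (p : Fin (k + 1)) (q : ℚ) (β γ : Fin (k + 1) → ℤ)
    (α : Fin (k + 1) → Fin (k + 1) → ℤ) : IsSemialgebraicFunOn ℚ (sband p) (smono q β γ α) :=
  isSemialgebraicFunOn_smono_comp (isSemialgebraic_sband p) q β γ α (X := fun t => t)
    fun i => isSemialgebraicFunOn_apply (isSemialgebraic_sband p) i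

/-- The axis logarithmic derivative is `ℚ`-semialgebraic on every `ℚ`-semialgebraic set (junk
values included). [cite: BochnakCosteRoy1998, Prop. 2.2.6] -/
theorem isSemialgebraicFunOn_logDer_single {S : Set (Fin (k + 1) → ℝ)} (hS : IsSemialgebraic ℚ S)
    (p : Fin (k + 1)) (β γ : Fin (k + 1) → ℤ) (α : Fin (k + 1) → Fin (k + 1) → ℤ) :
    IsSemialgebraicFunOn ℚ S (fun t => logDer β γ α t (Pi.single p 1)) := by
  simp only [logDer_single]
  have hap := fun i => isSemialgebraicFunOn_apply hS i
  have h0 : IsSemialgebraicFunOn ℚ S fun _ : Fin (k + 1) → ℝ => (0 : ℝ) := by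
    simpa using isSemialgebraicFunOn_const_ratCast hS 0
  have h1 : IsSemialgebraicFunOn ℚ S fun _ : Fin (k + 1) → ℝ => (1 : ℝ) := by
    simpa using isSemialgebraicFunOn_const_ratCast hS 1
  refine (IsSemialgebraicFunOn.fun_sub ?_ ?_).fun_add (IsSemialgebraicFunOn.fun_sub ?_ ?_)
  · simpa [div_eq_mul_inv] using (isSemialgebraicFunOn_const_intCast hS (β p)).fun_mul (hap p).fun_inv
  · simpa [div_eq_mul_inv] using
      (isSemialgebraicFunOn_const_intCast hS (γ p)).fun_mul (h1.fun_sub (hap p)).fun_inv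
  · refine IsSemialgebraicFunOn.fun_finsetSum _ hS fun j _ => ?_
    by_cases hj : p < j
    · simp only [if_pos hj]
      simpa [div_eq_mul_inv] using
        (isSemialgebraicFunOn_const_intCast hS (α p j)).fun_mul ((hap p).fun_sub (hap j)).fun_inv
    · simp only [if_neg hj]; exact h0
  · refine IsSemialgebraicFunOn.fun_finsetSum _ hS fun i _ => ?_
    by_cases hi : i < p
    · simp only [if_pos hi]
      simpa [div_eq_mul_inv] using
        (isSemialgebraicFunOn_const_intCast hS (α i p)).fun_mul ((hap i).fun_sub (hap p)).fun_inv
    · simp only [if_neg hi]; exact h0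

/-- The bulk `P · ∂_p log P` is `ℚ`-semialgebraic on the axis band. [cite: BochnakCosteRoy1998, Prop. 2.2.6] -/
theorem isSemialgebraicFunOn_bulk_sband (p : Fin (k + 1)) (q : ℚ) (β γ : Fin (k + 1) → ℤ)
    (α : Fin (k + 1) → Fin (k + 1) → ℤ) :
    IsSemialgebraicFunOn ℚ (sband p) (fun t => smono q β γ α t * logDer β γ α t (Pi.single p 1)) :=
  (isSemialgebraicFunOn_smono_sband p q β γ α).fun_mul
    (isSemialgebraicFunOn_logDer_single (isSemialgebraic_sband p) p β γ α)

/-! ### The move -/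

/-- **The monomial translation move.**  Rule (3) along the axis `p` of `Δᵏ⁺¹` with the Laurent
monomial `P = smono q β γ α` as primitive: if `R = [Δᵏ⁺¹, P · ∂_p log P]` (the bulk `∂_p P`) and
`rb = [Δᵏ, P(insertNth p (hiEdge p y) y) − P(insertNth p (loEdge p y) y)]` (the faces) are
representations, and the letters collapsing at the two end points of the fibre carry non-negative
exponents, then `[R] − [rb] ∈ KZ.relations`. [cite: KontsevichZagier2001, §1.2 rule (3)] -/
theorem smono_axis_move (p : Fin (k + 1)) (q : ℚ) (β γ : Fin (k + 1) → ℤ)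
    (α : Fin (k + 1) → Fin (k + 1) → ℤ) (R : KZ.IntegralRep (k + 1)) (rb : KZ.IntegralRep k)
    (hRdom : R.domain = KZ.openOrderedSimplex (k + 1))
    (hRW : EqOn R.integrand (fun t => smono q β γ α t * logDer β γ α t (Pi.single p 1)) R.domain)
    (hbdom : rb.domain = KZ.openOrderedSimplex k)
    (hbase : EqOn rb.integrand (fun y => smono q β γ α (Fin.insertNth p (hiEdge p y) y) -
      smono q β γ α (Fin.insertNth p (loEdge p y) y)) rb.domain)
    (hhi : if h : 0 < (p : ℕ) then 0 ≤ α ⟨(p : ℕ) - 1, by omega⟩ p else 0 ≤ γ p)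
    (hlo : if h : (p : ℕ) < k then 0 ≤ α p ⟨(p : ℕ) + 1, by omega⟩ else 0 ≤ β p) :
    KZ.of R - KZ.of rb ∈ KZ.relations :=
  nl_axis_osimplex p R rb (smono q β γ α) (fun t => smono q β γ α t * logDer β γ α t (Pi.single p 1))
    hRdom hRW hbdom (isSemialgebraicFunOn_bulk_sband p q β γ α) (isSemialgebraicFunOn_smono_sband p q β γ α)
    (fun _ hy => continuousOn_smono_axis p q β γ α hy hhi hlo)
    (fun _ hy _ hu => hasDerivAt_smono_axis p q β γ α hy hu)
    (fun y hy => hbase (by rw [hbdom]; exact hy))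

end TranslationNL

open TranslationNL in
/-- **Registered support stub `stub_deRhamAux1`** of `stub_deRham` (line `torus-descent-sum-shadow`):
the MONOMIAL TRANSLATION MOVE, fully spelled out.  For the Laurent monomial
`P = q·∏ tᵢ^{βᵢ}(1-tᵢ)^{γᵢ}∏_{i<j}(tᵢ-tⱼ)^{αᵢⱼ}` on `Δᵏ⁺¹ = {1 > t₀ > ⋯ > t_k > 0}` and an axis `p`:
if `R = [Δᵏ⁺¹, ∂_p P]` with
`∂_p P = P · (β_p/t_p − γ_p/(1−t_p) + Σ_{j>p} α_{pj}/(t_p−t_j) − Σ_{i<p} α_{ip}/(t_i−t_p))` and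
`rb = [Δᵏ, P|_{t_p → t_{p-1}} − P|_{t_p → t_{p+1}}]` (`t_p → 1` when `p = 0`, `t_p → 0` when `p = k`)
are representations, and the exponents of the two letters adjacent to the axis (`α_{p-1,p}`, resp.
`γ₀`; `α_{p,p+1}`, resp. `β_k`) are non-negative, then `[R] − [rb] ∈ KZ.relations`
(`= TranslationNL.smono_axis_move`, i.e. `VertexSplitting.nl_axis_osimplex` with all side
conditions discharged). [cite: KontsevichZagier2001, §1.2 rule (3)] -/
theorem stub_deRhamAux1 : ∀ (k : ℕ) (p : Fin (k + 1)) (q : ℚ) (β γ : Fin (k + 1) → ℤ) (α : Fin (k + 1) → Fin (k + 1) → ℤ) (R : Literature.NumberTheory.Transcendental.KZ.IntegralRep (k + 1)) (rb : Literature.NumberTheory.Transcendental.KZ.IntegralRep k), R.domain = {t : Fin (k + 1) → ℝ | (∀ i, 0 < t i) ∧ (∀ i, t i < 1) ∧ StrictAnti t} → Set.EqOn R.integrand (fun t => ((q : ℝ) * ((∏ i : Fin (k + 1), t i ^ β i) * (∏ i : Fin (k + 1), (1 - t i) ^ γ i) * ∏ i : Fin (k + 1), ∏ j : Fin (k + 1),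 if i < j then (t i - t j) ^ α i j else 1)) * ((β p : ℝ) / t p - (γ p : ℝ) / (1 - t p) + ((∑ j : Fin (k + 1), if p < j then (α p j : ℝ) / (t p - t j) else 0) - ∑ i : Fin (k + 1), if i < p then (α i p : ℝ) / (t i - t p) else 0))) R.domain → rb.domain = {t : Fin k → ℝ | (∀ i, 0 < t i) ∧ (∀ i, t i < 1) ∧ StrictAnti t} → Set.EqOn rb.integrand (fun y => (q : ℝ) * ((∏ i : Fin (k + 1), (Fin.insertNth p (if h : 0 < (p : ℕ) then y ⟨(p : ℕ) - 1, by omega⟩ else 1) y : Fin (k + 1) → ℝ) i ^ β i) * (∏ i : Fin (k + 1), (1 - (Fin.insertNth p (if h : 0 < (p : ℕ) then y ⟨(p : ℕ) - 1, by omega⟩ else 1) y : Fin (k + 1) → ℝ) i) ^ γ i) * ∏ i : Fin (k + 1), ∏ j : Fin (k + 1), if i < j then ((Fin.insertNth p (if h : 0 < (p : ℕ) then y ⟨(p : ℕ) - 1, by omega⟩ else 1) y : Fin (k + 1) → ℝ) i - (Fin.insertNth p (if h : 0 < (p : ℕ) then y ⟨(p : ℕ) - 1, by omega⟩ else 1)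 y : Fin (k + 1) → ℝ) j) ^ α i j else 1) - (q : ℝ) * ((∏ i : Fin (k + 1), (Fin.insertNth p (if h : (p : ℕ) < k then y ⟨p, h⟩ else 0) y : Fin (k + 1) → ℝ) i ^ β i) * (∏ i : Fin (k + 1), (1 - (Fin.insertNth p (if h : (p : ℕ) < k then y ⟨p, h⟩ else 0) y : Fin (k + 1) → ℝ) i) ^ γ i) * ∏ i : Fin (k + 1), ∏ j : Fin (k + 1), if i < j then ((Fin.insertNth p (if h : (p : ℕ) < k then y ⟨p, h⟩ else 0) y : Fin (k + 1) → ℝ) i - (Fin.insertNth p (if h : (p : ℕ) < k then y ⟨p, h⟩ else 0) y : Fin (k + 1) → ℝ) j) ^ α i j else 1)) rb.domain → (if h : 0 < (p : ℕ) then 0 ≤ α ⟨(p : ℕ) - 1, by omega⟩ p else 0 ≤ γ p) → (if h : (p : ℕ) < k then 0 ≤ α p ⟨(p : ℕ) + 1, by omega⟩ else 0 ≤ β p) → Literature.NumberTheory.Transcendental.KZ.of R - Literature.NumberTheory.Transcendental.KZ.of rb ∈ Literature.NumberTheory.Transcendental.KZ.relations := by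
  intro k p q β γ α R rb hRdom hRW hbdom hbase hhi hlo
  refine smono_axis_move p q β γ α R rb hRdom (fun t ht => ?_) hbdom hbase hhi hlo
  show R.integrand t = smono q β γ α t * logDer β γ α t (Pi.single p 1)
  rw [hRW ht, logDer_single]
  rfl

end Summit.KontsevichZagierPeriods.DihedralNormalForm.TorusDescent

end
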